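import Literature.AlgebraicGeometry.Resolution.GeometricallyIrreducibleOfBirational
import Literature.AlgebraicGeometry.Resolution.ProjectiveResolutionProofs
import Literature.AlgebraicGeometry.Motives.VarietiesProperProofs
import HarnessLib

/-!
# A projective geometrically irreducible variety over a field of characteristic zero has a SMOOTH, PROJECTIVE, GEOMETRICALLY
# IRREDUCIBLE resolution (Hironaka + «regular ⇒ smooth over a perfect field» + geometric irreducibility along birational maps)

Topic `Literature/AlgebraicGeometry/Resolution`. THEOREMS only (no definition, no named fact). Written by the prover seat
`hodge-nonav-19716-p2` (g12, cell `hodge-nonav`) as brick **QF-4 «GENERIC RESOLUTION»** (part L2, assembly) of prover-Bx's programme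
Q-FAMILY (memo `PROGRAMME-Q-FAMILY-Bx-g18.md` §6) for route `HodgeConjecture/Q8SymplecticPowers` (crux K1Q, stmt-HodgeConjecture-24190):
applied to the generic fibre `𝒱_K` (integral, projective, geometrically integral) of the universal quaternionic quartic it yields the
smooth projective geometrically irreducible `K`-surface `Y_K → 𝒱_K` that QF-2 «MODEL» spreads out over a basic open of `Spec ℂ[CIdx e]`.

* `exists_isResolution_smooth_geometricallyIrreducible` — for a field `k` of characteristic zero and an integral projective `k`-scheme
  `X` with `X → Spec k` geometrically irreducible: there are `Y` and `ρ : Y ⟶ X` with `IsResolution ρ` (proper, birational, `Y`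
  regular), `Y` PROJECTIVE over `k` (`IsProjectiveOver (Over.mk (ρ ≫ X.hom))`), `Y → Spec k` SMOOTH and GEOMETRICALLY IRREDUCIBLE.
  Proof: the tree's projective Hironaka `exists_isResolution_isProjectiveOver_of_isProjectiveOver` (Kollár 2007 Cor. 3.22 / Thm. 3.36);
  `smooth_of_isRegular_of_perfectField` (Matsumura §30; `k` is perfect in characteristic zero; `Y → Spec k` is locally of finite type,
  being proper as a projective `k`-scheme, `IsProjectiveOver.isProper`); `geometricallyIrreducible_of_isResolution` (this seat, L1).
Honest scope: assembly of tree theorems; nothing here is specific to the quaternionic family, and nothing says HC or any rung is proved.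

## References

* [Kollar2007] J. Kollár, Lectures on Resolution of Singularities (2007), Cor. 3.22, Thm. 3.36.
* [Hironaka1964] H. Hironaka, Resolution of singularities of an algebraic variety over a field of characteristic zero, Main Theorem I.
* [Matsumura1987] H. Matsumura, Commutative Ring Theory (1987), §30 Remark 2 after Thm. 30.3.
* [StacksProject] The Stacks Project, Tag 038F.
-/

noncomputable section

open CategoryTheory CategoryTheory.Limits AlgebraicGeometry TopologicalSpace

namespace Literature.AlgebraicGeometry.Resolution

universe u

/-- **Smooth projective geometrically irreducible resolution** (characteristic zero): an integral projective `k`-scheme `X` with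
`X → Spec k` geometrically irreducible admits `ρ : Y ⟶ X` with `IsResolution ρ`, `Y` projective over `k`, and `Y → Spec k` smooth and
geometrically irreducible. [cite: Kollar2007, Cor. 3.22 and Thm. 3.36] [cite: Matsumura1987, §30 Remark 2 after Thm. 30.3]
[cite: StacksProject, Tag 038F] -/
theorem exists_isResolution_smooth_geometricallyIrreducible {k : Type u} [Field k] [CharZero k]
    (X : Literature.AlgebraicGeometry.Motives.SchemeOver k) [IsIntegral X.left]
    (hX : Literature.AlgebraicGeometry.Motives.IsProjectiveOver X) [GeometricallyIrreducible X.hom] :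
    ∃ (Y : Scheme.{u}) (ρ : Y ⟶ X.left), IsResolution ρ ∧
      Literature.AlgebraicGeometry.Motives.IsProjectiveOver (Over.mk (ρ ≫ X.hom)) ∧
      Smooth (ρ ≫ X.hom) ∧ GeometricallyIrreducible (ρ ≫ X.hom) := by
  obtain ⟨Y, ρ, hρ, hproj⟩ := exists_isResolution_isProjectiveOver_of_isProjectiveOver X hX
  refine ⟨Y, ρ, hρ, hproj, ?_, geometricallyIrreducible_of_isResolution X.hom hρ⟩
  -- `Y → Spec k` is proper (projective), in particular locally of finite type; `Y` is regular and `k` is perfect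
  haveI : IsProper (ρ ≫ X.hom) :=
    Literature.AlgebraicGeometry.Motives.IsProjectiveOver.isProper (X := (Over.mk (ρ ≫ X.hom) : Literature.AlgebraicGeometry.Motives.SchemeOver k)) hproj
  exact smooth_of_isRegular_of_perfectField (ρ ≫ X.hom) hρ.isRegular

end Literature.AlgebraicGeometry.Resolution

end
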